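/-
Origin: expansion seat `planner-pub-hodgecm-mc-axioms-1-g14-0`, handover #W151 2026-08-20T15:53:55Z md5 7a28a1fdc8fc (PKG ea651eca7cda → 7a28a1fdc8fc; 106 l.; MECHANICAL (iib-R) rewrite v3.1 of the PKG file as it stands (38 token edits; rules R1x1+RX[h₂]x37)) (`HOME/mc/pub-hodgecm-mc-axioms-1-g14/revendor/kit-r55/stage55/HodgeCM/Model/LevelTransferOf.lean`, md5 7a28a1fdc8fc, 106 lines);
landed by the gen-22 packager (p-g22) in gate run 55 REPLACES the earlier landed copy of `HodgeCM/Model/LevelTransferOf.lean` (seat copy carried the packager Origin header of an earlier run (stripped)).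
-/
/-
Origin: CONSTRUCTION seat `planner-pub-hodgecm-mc-axioms-1-g7-0` (unit pub-hodgecm-mc-axioms-1-g7, gen 7 of lineage
mc-axioms-1; MODEL-DAG node N-i1, ruling (L-lvl); desk booking model2-g5 (RRR′) 2026-08-19T07:08:33Z). NEW additive leaf
`HodgeCM/Model/LevelTransferOf.lean`. Imports: this lineage's `Model/LevelTransferPush` (gen 7, the push half, KERNEL) and
`Model/LevelDescent` (gen 6, staged kit t35 row #1: the record `Universe.LevelTransfer`). Nothing imports this file
(bounce-isolated). Expected `#print axioms`: {propext, Classical.choice, Quot.sound}.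
-/
import Summits.HodgeConjecture.HodgeCM.Model.LevelTransferPush
import Summits.HodgeConjecture.HodgeCM.Model.LevelDescent

/-!
# The level transfer datum `D` of `hLiu_of_small`, assembled: push half CONSTRUCTED, norm half as binders

`Model.hLiu_of_small` (`HodgeCM/Model/HLiuOfSmall.lean`, gen 6) turns the `[Liu21]`-shaped small-level statement into the
E binder `hLiu` of `Model.perL_picardCM_rNcore` given ONE datum

  `D : ∀ {L ι₁ V} (Γ Γ₁ : Level V) (hle : Γ₁.Γ ≤ Γ.Γ), U.LevelTransfer (coverOf … hA Γ Γ₁ hle)`,  `U := picardCMUniverse …`.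

Here that datum is ASSEMBLED, `levelTransferOf` / `levelTransferFamilyOf`, from

* the four KERNEL terms of `HodgeCM/Model/LevelTransferPush.lean` — `deg := degOf …` (number of sheets of the finite
  covering `coverOf … (ℂ)`), `deg_pos := degOf_pos …`, `push := pushOf …` (`deg •` the normalised transfer),
  `push_pull := pushOf_comp_pull …` (`push ∘ₗ p^* = deg • id`) — and
* the two remaining fields as EXPLICIT BINDERS: `norm` (for each morphism `F : X_{Γ₁} → A_{(K,Ψ)}` to a CM abelian variety
  of the universe, a morphism `N_F : X_Γ → A_{(K,Ψ)}`) and `hnorm` (`push ∘ₗ F^* = N_F^*` on `H¹`).  Intended model of the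
  binders: the norm `N_F(x) = Σ_{y ∈ p⁻¹(x)} F(y)` (sum in the group law of `A`; a morphism of varieties by descent along
  the finite étale `p`) and the `H¹`-additivity of pull-backs to a complex torus — NOT constructed in this package (no
  symmetric powers / finite group quotients of projective schemes are available to write `N_F` as a scheme morphism).

So after this file the datum `D` of `hLiu_of_small` costs exactly the pair (`norm`, `hnorm`) and no other input.
-/

noncomputable section

namespace HodgeCM

namespace Model

open Literature.AlgebraicGeometry.Motives (CMType)
open Literature.AlgebraicGeometry.HodgeTheory
open Literature.NumberTheory.Automorphic.PicardCM
open Literature.NumberTheory.Transcendental (Arapura2012_Cor_15_4_6)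

variable (hHD : exists_isReal_hodgeModel) (hI : hodgePQ_independent_of_hodgeModel)
  (h₁ : BallQuotientUniformised)  (h₃ : CMAbelianVarietyRealised)

/-- **The level transfer datum on `coverOf … Γ Γ₁ hle`**, push half constructed (`degOf`, `degOf_pos`, `pushOf`,
`pushOf_comp_pull`), norm half (`norm`, `hnorm`) supplied. -/
def levelTransferOf (hA : Arapura2012_Cor_15_4_6) {L : CMField} {ι₁ : L →+* ℂ} {V : HermSpace3 L ι₁}
    (Γ Γ₁ : Level V) (hle : Γ₁.Γ ≤ Γ.Γ)
    (norm : ∀ (K : CMField) (Ψ : CMType K),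
      (picardCMUniverse hHD hI h₁ h₃).Mor ((picardCMUniverse hHD hI h₁ h₃).pms L ι₁ V Γ₁)
          ((picardCMUniverse hHD hI h₁ h₃).cmAV K Ψ) →
        (picardCMUniverse hHD hI h₁ h₃).Mor ((picardCMUniverse hHD hI h₁ h₃).pms L ι₁ V Γ)
          ((picardCMUniverse hHD hI h₁ h₃).cmAV K Ψ))
    (hnorm : ∀ (K : CMField) (Ψ : CMType K)
      (F : (picardCMUniverse hHD hI h₁ h₃).Mor ((picardCMUniverse hHD hI h₁ h₃).pms L ι₁ V Γ₁)
        ((picardCMUniverse hHD hI h₁ h₃).cmAV K Ψ)),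
      pushOf hHD hI h₁ h₃ hA Γ Γ₁ hle ∘ₗ (picardCMUniverse hHD hI h₁ h₃).pull F 1 =
        (picardCMUniverse hHD hI h₁ h₃).pull (norm K Ψ F) 1) :
    (picardCMUniverse hHD hI h₁ h₃).LevelTransfer (coverOf hHD hI h₁ h₃ hA Γ Γ₁ hle) where
  deg := degOf hHD hI h₁ h₃ hA Γ Γ₁ hle
  deg_pos := degOf_pos hHD hI h₁ h₃ hA Γ Γ₁ hle
  push := pushOf hHD hI h₁ h₃ hA Γ Γ₁ hle
  push_pull := pushOf_comp_pull hHD hI h₁ h₃ hA Γ Γ₁ hle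
  norm := norm
  push_pull_norm := hnorm

/-- The constructed datum has the number of sheets of the level covering as its degree (by definition). -/
theorem levelTransferOf_deg (hA : Arapura2012_Cor_15_4_6) {L : CMField} {ι₁ : L →+* ℂ} {V : HermSpace3 L ι₁}
    (Γ Γ₁ : Level V) (hle : Γ₁.Γ ≤ Γ.Γ) (norm) (hnorm) :
    (levelTransferOf hHD hI h₁ h₃ hA Γ Γ₁ hle norm hnorm).deg = degOf hHD hI h₁ h₃ hA Γ Γ₁ hle := rfl

/-- … and `deg •` the normalised transfer as its push-forward (by definition). -/
theorem levelTransferOf_push (hA : Arapura2012_Cor_15_4_6) {L : CMField} {ι₁ : L →+* ℂ} {V : HermSpace3 L ι₁}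
    (Γ Γ₁ : Level V) (hle : Γ₁.Γ ≤ Γ.Γ) (norm) (hnorm) :
    (levelTransferOf hHD hI h₁ h₃ hA Γ Γ₁ hle norm hnorm).push = pushOf hHD hI h₁ h₃ hA Γ Γ₁ hle := rfl

/-- **The family `D` of `hLiu_of_small`**, from a family of norm halves: for all hermitian spaces and nested levels at
once. -/
def levelTransferFamilyOf (hA : Arapura2012_Cor_15_4_6)
    (norm : ∀ {L : CMField} {ι₁ : L →+* ℂ} {V : HermSpace3 L ι₁} (Γ Γ₁ : Level V) (_hle : Γ₁.Γ ≤ Γ.Γ)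
      (K : CMField) (Ψ : CMType K),
      (picardCMUniverse hHD hI h₁ h₃).Mor ((picardCMUniverse hHD hI h₁ h₃).pms L ι₁ V Γ₁)
          ((picardCMUniverse hHD hI h₁ h₃).cmAV K Ψ) →
        (picardCMUniverse hHD hI h₁ h₃).Mor ((picardCMUniverse hHD hI h₁ h₃).pms L ι₁ V Γ)
          ((picardCMUniverse hHD hI h₁ h₃).cmAV K Ψ))
    (hnorm : ∀ {L : CMField} {ι₁ : L →+* ℂ} {V : HermSpace3 L ι₁} (Γ Γ₁ : Level V) (hle : Γ₁.Γ ≤ Γ.Γ)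
      (K : CMField) (Ψ : CMType K)
      (F : (picardCMUniverse hHD hI h₁ h₃).Mor ((picardCMUniverse hHD hI h₁ h₃).pms L ι₁ V Γ₁)
        ((picardCMUniverse hHD hI h₁ h₃).cmAV K Ψ)),
      pushOf hHD hI h₁ h₃ hA Γ Γ₁ hle ∘ₗ (picardCMUniverse hHD hI h₁ h₃).pull F 1 =
        (picardCMUniverse hHD hI h₁ h₃).pull (norm Γ Γ₁ hle K Ψ F) 1) :
    ∀ {L : CMField} {ι₁ : L →+* ℂ} {V : HermSpace3 L ι₁} (Γ Γ₁ : Level V) (hle : Γ₁.Γ ≤ Γ.Γ),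
      (picardCMUniverse hHD hI h₁ h₃).LevelTransfer (coverOf hHD hI h₁ h₃ hA Γ Γ₁ hle) :=
  fun Γ Γ₁ hle ↦ levelTransferOf hHD hI h₁ h₃ hA Γ Γ₁ hle (norm Γ Γ₁ hle) (hnorm Γ Γ₁ hle)

end Model

end HodgeCM

end
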